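import Summits.ResolutionOfSingularities.ResolutionOfSingularities.Theorems.FrobeniusLadderFInjectiveMacaulayficationODPCurveBlowupRegular
import Summits.ResolutionOfSingularities.ResolutionOfSingularities.Theorems.FrobeniusLadderFInjectiveMacaulayficationPointFixableTransport
import Literature.AlgebraicGeometry.Motives.HypersurfaceFormsIrreducible
import Mathlib.RingTheory.MvPolynomial.Basic
import HarnessLib

/-!
# E4″@G floor 2: the blowing up of the `w`-chart `a′b′ + w(1 + U³ + V³) = 0` of `Bl_𝔪 G` along its singular curve `E = V(a′, b′, w, 1 + U³ + V³)` IS REGULAR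
# (E4″@G T-side (F3-w), part 3 of 3 — the specialisation of `ODPCurveCentre` / `ODPCurveBlowupRegular` to `Λ = k[U, V]`, `g = 1 + U³ + V³`, and the bridge to the
# `Fin 5` coordinates of res-L1-w45a-stub-2's chart `g₂ = X₀X₁ + X₂(1 + X₃³ + X₄³)` of `E4GermPointBlowupFull`; crux `FInjectiveMacaulayfication` stmt-ResolutionOfSingularities-15315,
# chain w45a; res-L1-w45a-plan-1 R19.1/R19.3; seat res-L1-w45a-stub-1 g11)

[OURS · L1 W4.5a] Support file (`--supports stmt-ResolutionOfSingularities-15315 --as helper`); replaces the role of NO printed item; NOT a statement of any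
manuscript; def-free; UNCONDITIONAL. AI-written (AI review is weaker than expert review).

* §1 `Λ = k[U, V]`, `g = 1 + U³ + V³` over a field with `3 ≠ 0` (e.g. characteristic 2): `prime_g` (as `T³ + C(U³ + 1)` over `k[U]`, Eisenstein at `U = −1` where
  `U³ + 1 = 0` and `∂_U = 3U² = 3 ≠ 0` — `HypersurfaceFormsIrreducible.irreducible_X_pow_add_C`), `g_ne_zero`, `isDomain_quotient_g`; the EULER DERIVATION
  `D₀ = U∂_U + V∂_V`: `euler_g` (`D₀ g = 3U³ + 3V³ = 3(g − 1)`), ★ `isUnit_mk_euler_g` (`D₀ g ≡ −3`, a unit modulo `g`).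
* §2 generic transports `isRegularRing_blowupAlgebra_of_ringEquiv`, `isRegularLocalRing_localization_iff_of_ringEquiv`, and the coordinate bridge over an ABSTRACT copy
  `ι : k[U,V] ≃+* Λ` (so that the two polynomial layers are never unified against each other): `exists_ringEquiv_fin5` (`k[X₀..X₄] ≃+* Λ[T₀,T₁,T₂]`, `X₃ ↦ C(ιU)`,
  `X₄ ↦ C(ιV)`; Mathlib `renameEquiv finSumFinEquiv.symm`, `sumAlgEquiv`, `mapEquiv`), `exists_quotientEquiv_chartTwo` (`C₂ ≃+* Λ[T]/(h)` matching the centres).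
* §3 the `Fin 5` frame of `E4GermPointBlowupFull` (chart `i = 2`: `C₂ = k[X₀..X₄]/(g₂)`, `g₂ = X₀X₁ + X₂(1 + X₃³ + X₄³)`, centre `c₂ = (X₀, X₁, X₂, 1 + X₃³ + X₄³)`,
  `J₂ = (c₂)·C₂`): ★★ `isRegularRing_blowupAlgebra_chartTwo` (the four chart rings `C₂[J₂/c̄]` are regular), ★★ `isRegular_affineBlowup_chartTwo`
  (`Scheme.IsRegular (affineBlowup J₂)`), ★ `not_isRegularLocalRing_iff_chartTwo` (`Sing(Spec C₂) = V(J₂)`) — the (F3)/(F2) inputs for the chart `D₊(w₁)`; the charts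
  `D₊(w₂)`, `D₊(w₃)` follow by the variable swaps `(2 3)`, `(2 4)` (next file).
[folklore; cite: Liu2002, Thm. 8.1.19 (a); StacksProject, Tag 07PF, Tag 0BIQ; GortzWedhorn2020, Prop. 13.96 (2); Hartshorne1977, II Ex. 8.20.2 (pattern)]
-/

-- single-problem summit: the doubled namespace component is forced
set_option linter.dupNamespace false

noncomputable section

namespace Summit.ResolutionOfSingularities.ResolutionOfSingularities.Theorems.FInjectiveMacaulayfication.E4FloorTwoWChart

open MvPolynomial Literature.AlgebraicGeometry.Resolution AlgebraicGeometry
open Summit.ResolutionOfSingularities.ResolutionOfSingularities.Theorems.FInjectiveMacaulayfication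

/-! ## §1 `g = 1 + U³ + V³ ∈ k[U, V]`: prime, and the Euler derivation makes `Λ/(g)` regular -/

/-- **`g = 1 + U³ + V³` is prime** when `3 ≠ 0` in `k`: `k[U,V] ≅ k[U][T]` (`V ↦ T`… here `U = X 0 ↦ T`, `V = X 1 ↦ C(X 0)`), `g ↦ T³ + C(X₀³ + 1)`, Eisenstein at the
point `X₀ = −1` (`X₀³ + 1 = 0`, `∂(X₀³ + 1)/∂X₀ = 3X₀² = 3 ≠ 0`). [folklore; cite: Hartshorne1977, II Ex. 8.20.2 (pattern)] -/
theorem prime_g (k : Type) [Field k] (h3 : (3 : k) ≠ 0) (g : MvPolynomial (Fin 2) k) (hg : g = 1 + X 0 ^ 3 + X 1 ^ 3) : Prime g := by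
  set e : MvPolynomial (Fin 2) k ≃+* Polynomial (MvPolynomial (Fin 1) k) := (finSuccEquiv k 1).toRingEquiv with he_def
  have he0 : e (X 0) = Polynomial.X := finSuccEquiv_X_zero
  have he1 : e (X 1) = Polynomial.C (X 0) := by
    rw [show (1 : Fin 2) = (0 : Fin 1).succ from rfl]
    exact finSuccEquiv_X_succ
  have hef : e g = Polynomial.X ^ 3 + Polynomial.C (X 0 ^ 3 + 1 : MvPolynomial (Fin 1) k) := by
    rw [hg, map_add, map_add, map_pow, map_pow, map_one, he0, he1, map_add, map_pow, map_one]
    ring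
  have hc : MvPolynomial.eval (fun _ : Fin 1 => (-1 : k)) (X 0 ^ 3 + 1 : MvPolynomial (Fin 1) k) = 0 := by
    simp only [map_add, map_pow, eval_X, map_one]
    norm_num
  have hder : MvPolynomial.eval (fun _ : Fin 1 => (-1 : k)) (pderiv 0 (X 0 ^ 3 + 1 : MvPolynomial (Fin 1) k)) ≠ 0 := by
    have e1 : pderiv 0 (X 0 ^ 3 + 1 : MvPolynomial (Fin 1) k) = 3 * X 0 ^ 2 := by
      rw [map_add, Derivation.map_one_eq_zero, add_zero, pderiv_pow, pderiv_X_self]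
      push_cast
      ring
    rw [e1, map_mul, map_pow, eval_X, map_ofNat]
    norm_num
    exact h3
  have hirr : Irreducible (e g) := by
    rw [hef]
    exact Literature.AlgebraicGeometry.Motives.SmoothHypersurface.irreducible_X_pow_add_C (d := 3) (by norm_num) _ _ hc 0 hder
  exact (MulEquiv.prime_iff e).mp hirr.prime

/-- `g ≠ 0`. [plumbing] -/
theorem g_ne_zero (k : Type) [Field k] (h3 : (3 : k) ≠ 0) (g : MvPolynomial (Fin 2) k) (hg : g = 1 + X 0 ^ 3 + X 1 ^ 3) : g ≠ 0 :=
  (prime_g k h3 g hg).ne_zero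

/-- `k[U,V]/(g)` is a domain. [folklore] -/
theorem isDomain_quotient_g (k : Type) [Field k] (h3 : (3 : k) ≠ 0) (g : MvPolynomial (Fin 2) k) (hg : g = 1 + X 0 ^ 3 + X 1 ^ 3) :
    IsDomain (MvPolynomial (Fin 2) k ⧸ Ideal.span {g}) :=
  haveI := (Ideal.span_singleton_prime (g_ne_zero k h3 g hg)).mpr (prime_g k h3 g hg)
  Ideal.Quotient.isDomain _

/-- **The Euler derivation on `g`**: `(U∂_U + V∂_V) g = 3U³ + 3V³`. [folklore] -/
theorem euler_g (k : Type) [Field k] (g : MvPolynomial (Fin 2) k) (hg : g = 1 + X 0 ^ 3 + X 1 ^ 3) :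
    ((X 0 : MvPolynomial (Fin 2) k) • (pderiv 0 : Derivation k (MvPolynomial (Fin 2) k) (MvPolynomial (Fin 2) k)) +
        (X 1 : MvPolynomial (Fin 2) k) • (pderiv 1 : Derivation k (MvPolynomial (Fin 2) k) (MvPolynomial (Fin 2) k))) g =
      3 * X 0 ^ 3 + 3 * X 1 ^ 3 := by
  rw [hg, Derivation.add_apply, Derivation.smul_apply, Derivation.smul_apply]
  simp only [map_add, Derivation.map_one_eq_zero, pderiv_pow, pderiv_X_self, pderiv_X_of_ne (show (1 : Fin 2) ≠ 0 by decide),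
    pderiv_X_of_ne (show (0 : Fin 2) ≠ 1 by decide), smul_eq_mul, mul_zero, mul_one, zero_add, add_zero]
  push_cast
  ring

/-- ★ **`D₀ g` is a unit modulo `g`** for the Euler derivation `D₀ = U∂_U + V∂_V` when `3 ≠ 0` in `k`: `D₀ g = 3(g − 1) ≡ −3`. So `k[U,V]/(g)` is a regular ring by
Stacks 07PF (`isRegularRing_quotient_of_derivation`) — the smooth affine Fermat cubic. [folklore; cite: StacksProject, Tag 07PF] -/
theorem isUnit_mk_euler_g (k : Type) [Field k] (h3 : (3 : k) ≠ 0) (g : MvPolynomial (Fin 2) k) (hg : g = 1 + X 0 ^ 3 + X 1 ^ 3) :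
    IsUnit (Ideal.Quotient.mk (Ideal.span {g})
      (((X 0 : MvPolynomial (Fin 2) k) • (pderiv 0 : Derivation k (MvPolynomial (Fin 2) k) (MvPolynomial (Fin 2) k)) +
        (X 1 : MvPolynomial (Fin 2) k) • (pderiv 1 : Derivation k (MvPolynomial (Fin 2) k) (MvPolynomial (Fin 2) k))) g)) := by
  rw [euler_g k g hg]
  have hrw : (3 * X 0 ^ 3 + 3 * X 1 ^ 3 : MvPolynomial (Fin 2) k) = 3 * g - 3 := by rw [hg]; ring
  have hg0 : Ideal.Quotient.mk (Ideal.span {g}) g = 0 := Ideal.Quotient.eq_zero_iff_mem.mpr (Ideal.mem_span_singleton_self g)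
  rw [hrw, map_sub, map_mul, hg0, mul_zero, zero_sub, map_ofNat]
  have h3u : IsUnit ((3 : MvPolynomial (Fin 2) k ⧸ Ideal.span {g})) := by
    have := (Ne.isUnit h3).map (algebraMap k (MvPolynomial (Fin 2) k ⧸ Ideal.span {g}))
    rwa [map_ofNat] at this
  exact h3u.neg

/-! ## §2 Generic transports and the coordinate bridge `k[X₀..X₄] ≃ Λ[T₀, T₁, T₂]` -/

/-- **Regularity of an affine blowup algebra transports along ring isomorphisms of the base** (`ReesChartCongr.exists_blowupAlgebra_congr`). [folklore] -/
theorem isRegularRing_blowupAlgebra_of_ringEquiv {A B : Type} [CommRing A] [CommRing B] (e : A ≃+* B) (I : Ideal A) (a : A)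
    (I' : Ideal B) (a' : B) (hI' : I' = Ideal.map e I) (ha' : a' = e a) (hreg : IsRegularRing (blowupAlgebra I' a')) :
    IsRegularRing (blowupAlgebra I a) := by
  obtain ⟨E, -⟩ := PointFixableTransport.exists_blowupAlgebra_congr' e I a I' a' hI' ha'
  haveI := hreg
  exact IsRegularRing.of_ringEquiv (R := blowupAlgebra I' a') E.symm

/-- **Regularity of the local ring at a prime transports along ring isomorphisms** (`IsLocalization.ringEquivOfRingEquiv`; `P = e⁻¹ Q`). [folklore] -/
theorem isRegularLocalRing_localization_iff_of_ringEquiv {A B : Type} [CommRing A] [CommRing B] (e : A ≃+* B) (P : Ideal A) (Q : Ideal B)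
    [P.IsPrime] [Q.IsPrime] (hPQ : P = Q.comap e) :
    IsRegularLocalRing (Localization.AtPrime P) ↔ IsRegularLocalRing (Localization.AtPrime Q) := by
  subst hPQ
  let E : Localization.AtPrime (Q.comap e) ≃+* Localization.AtPrime Q :=
    IsLocalization.ringEquivOfRingEquiv (Localization.AtPrime (Q.comap e)) (Localization.AtPrime Q) e (e.map_primeCompl_comap_eq Q)
  exact ⟨fun _ => IsRegularLocalRing.of_ringEquiv E, fun _ => IsRegularLocalRing.of_ringEquiv E.symm⟩

/-- **`k[X₀, …, X₄] ≃+* Λ[T₀, T₁, T₂]` over a ring isomorphism `ι : k[U, V] ≃+* Λ`**: `X₀, X₁, X₂ ↦ T₀, T₁, T₂`, `X₃ ↦ C(ι U)`, `X₄ ↦ C(ι V)`, `c ↦ C(ι c)`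
(Mathlib `renameEquiv finSumFinEquiv.symm`, `sumAlgEquiv`, `mapEquiv`). Keeping `Λ` ABSTRACT here is deliberate: all chart algebra is then instantiated by pure
application, never by unification across the two polynomial layers. [folklore] -/
theorem exists_ringEquiv_fin5 (k : Type) [Field k] {Λ : Type} [CommRing Λ] (ι : MvPolynomial (Fin 2) k ≃+* Λ) :
    ∃ ε : MvPolynomial (Fin 5) k ≃+* MvPolynomial (Fin 3) Λ,
      ε (X 0) = X 0 ∧ ε (X 1) = X 1 ∧ ε (X 2) = X 2 ∧ ε (X 3) = C (ι (X 0)) ∧ ε (X 4) = C (ι (X 1)) ∧ ∀ c : k, ε (C c) = C (ι (C c)) := by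
  let ε₀ : MvPolynomial (Fin 5) k ≃+* MvPolynomial (Fin 3) (MvPolynomial (Fin 2) k) :=
    ((renameEquiv k (finSumFinEquiv (m := 3) (n := 2)).symm).trans (sumAlgEquiv k (Fin 3) (Fin 2))).toRingEquiv
  have hX : ∀ j : Fin 5, ε₀ (X j) = sumAlgEquiv k (Fin 3) (Fin 2) (X ((finSumFinEquiv (m := 3) (n := 2)).symm j)) := by
    intro j
    change sumAlgEquiv k (Fin 3) (Fin 2) (renameEquiv k _ (X j)) = _
    rw [renameEquiv_apply, rename_X]
  have h0 : ε₀ (X 0) = X 0 := by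
    rw [hX, show (finSumFinEquiv (m := 3) (n := 2)).symm (0 : Fin 5) = Sum.inl 0 by decide, sumAlgEquiv_X_inl]
  have h1 : ε₀ (X 1) = X 1 := by
    rw [hX, show (finSumFinEquiv (m := 3) (n := 2)).symm (1 : Fin 5) = Sum.inl 1 by decide, sumAlgEquiv_X_inl]
  have h2 : ε₀ (X 2) = X 2 := by
    rw [hX, show (finSumFinEquiv (m := 3) (n := 2)).symm (2 : Fin 5) = Sum.inl 2 by decide, sumAlgEquiv_X_inl]
  have h3 : ε₀ (X 3) = C (X 0) := by
    rw [hX, show (finSumFinEquiv (m := 3) (n := 2)).symm (3 : Fin 5) = Sum.inr 0 by decide, sumAlgEquiv_X_inr]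
  have h4 : ε₀ (X 4) = C (X 1) := by
    rw [hX, show (finSumFinEquiv (m := 3) (n := 2)).symm (4 : Fin 5) = Sum.inr 1 by decide, sumAlgEquiv_X_inr]
  have hC : ∀ c : k, ε₀ (C c) = C (C c) := fun c => by
    change sumAlgEquiv k (Fin 3) (Fin 2) (renameEquiv k _ (C c)) = _
    rw [renameEquiv_apply, rename_C, sumAlgEquiv_C_inl]
  -- change coefficients along `ι`
  let ε := ε₀.trans (mapEquiv (Fin 3) ι)
  have hε : ∀ x, ε x = MvPolynomial.map (ι : MvPolynomial (Fin 2) k →+* Λ) (ε₀ x) := fun x => rfl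
  refine ⟨ε, ?_, ?_, ?_, ?_, ?_, fun c => ?_⟩
  · rw [hε, h0, map_X]
  · rw [hε, h1, map_X]
  · rw [hε, h2, map_X]
  · rw [hε, h3, map_C]; rfl
  · rw [hε, h4, map_C]; rfl
  · rw [hε, hC, map_C]; rfl

/-- **The quotient bridge `C₂ ≃+* Λ[T]/(h)`** carrying the centre `(X₀, X₁, X₂, 1 + X₃³ + X₄³)·C₂` onto `(T₀, T₁, T₂, C g)·(R/(h))` generator by generator, for
`g = ι(1 + U³ + V³)`. [plumbing] -/
theorem exists_quotientEquiv_chartTwo (k : Type) [Field k] {Λ : Type} [CommRing Λ] (ι : MvPolynomial (Fin 2) k ≃+* Λ)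
    (g₂ : MvPolynomial (Fin 5) k) (hg₂ : g₂ = X 0 * X 1 + X 2 * (1 + X 3 ^ 3 + X 4 ^ 3))
    (c₂ : Fin 4 → MvPolynomial (Fin 5) k) (hc₂ : c₂ = ![X 0, X 1, X 2, 1 + X 3 ^ 3 + X 4 ^ 3])
    (J₂ : Ideal (MvPolynomial (Fin 5) k ⧸ Ideal.span {g₂})) (hJ₂ : J₂ = (Ideal.span (Set.range c₂)).map (Ideal.Quotient.mk (Ideal.span {g₂})))
    (g : Λ) (hg : g = ι (1 + X 0 ^ 3 + X 1 ^ 3))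
    (cen : Fin 4 → MvPolynomial (Fin 3) Λ) (hcen : cen = ![X 0, X 1, X 2, C g])
    (h : MvPolynomial (Fin 3) Λ) (hh : h = X 0 * X 1 + X 2 * C g) :
    ∃ εq : (MvPolynomial (Fin 5) k ⧸ Ideal.span {g₂}) ≃+* (MvPolynomial (Fin 3) Λ ⧸ Ideal.span {h}),
      (∀ p, εq (Ideal.Quotient.mk (Ideal.span {g₂}) (c₂ p)) = Ideal.Quotient.mk (Ideal.span {h}) (cen p)) ∧
        Ideal.map εq J₂ = (Ideal.span (Set.range cen)).map (Ideal.Quotient.mk (Ideal.span {h})) := by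
  obtain ⟨ε, e0, e1, e2, e3, e4, -⟩ := exists_ringEquiv_fin5 k ι
  have eg : ε (1 + X 3 ^ 3 + X 4 ^ 3) = C g := by
    rw [hg]
    simp only [map_add, map_one, map_pow, e3, e4]
  have hεg : ε g₂ = h := by rw [hg₂, hh, map_add, map_mul, map_mul, e0, e1, e2, eg]
  have hεc : ∀ p, ε (c₂ p) = cen p := by
    intro p
    subst hc₂ hcen
    fin_cases p
    · exact e0
    · exact e1
    · exact e2
    · exact eg
  have hmap : Ideal.span {h} = (Ideal.span {g₂}).map (ε : MvPolynomial (Fin 5) k →+* MvPolynomial (Fin 3) Λ) := by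
    rw [Ideal.map_span, Set.image_singleton]
    exact congrArg _ (congrArg _ hεg.symm)
  let εq := Ideal.quotientEquiv (Ideal.span {g₂}) (Ideal.span {h}) ε hmap
  have hεq : ∀ x, εq (Ideal.Quotient.mk (Ideal.span {g₂}) x) = Ideal.Quotient.mk (Ideal.span {h}) (ε x) := fun x =>
    Ideal.quotientEquiv_mk _ _ _ _ x
  refine ⟨εq, fun p => by rw [hεq, hεc], ?_⟩
  have hcomp : (εq : _ →+* _).comp (Ideal.Quotient.mk (Ideal.span {g₂})) =
      (Ideal.Quotient.mk (Ideal.span {h})).comp (ε : MvPolynomial (Fin 5) k →+* MvPolynomial (Fin 3) Λ) :=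
    RingHom.ext fun x => hεq x
  have hfun : ((ε : MvPolynomial (Fin 5) k →+* MvPolynomial (Fin 3) Λ) ∘ c₂ : Fin 4 → _) = cen :=
    funext fun p => by rw [Function.comp_apply, RingEquiv.coe_toRingHom]; exact hεc p
  have key : Ideal.map (εq : _ →+* _) J₂ = (Ideal.span (Set.range cen)).map (Ideal.Quotient.mk (Ideal.span {h})) := by
    rw [hJ₂, Ideal.map_map, hcomp, ← Ideal.map_map, Ideal.map_span, ← Set.range_comp, hfun]
  exact key

/-! ## §3 The chart `C₂ = k[X₀..X₄]/(X₀X₁ + X₂(1 + X₃³ + X₄³))` of `Bl_𝔪 G` and its centre `(X₀, X₁, X₂, 1 + X₃³ + X₄³)` -/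

/-- The four chart rings of `Bl_{J₂} Spec C₂` over an ABSTRACT copy `Λ` of `k[U,V]` (instantiate with `ι = RingEquiv.refl`). [plumbing] -/
theorem isRegularRing_blowupAlgebra_chartTwo_aux (k : Type) [Field k] {Λ : Type} [CommRing Λ] [IsRegularRing Λ] (ι : MvPolynomial (Fin 2) k ≃+* Λ)
    (g : Λ) (hg : g = ι (1 + X 0 ^ 3 + X 1 ^ 3)) [IsDomain (Λ ⧸ Ideal.span {g})] (hg0 : IsSMulRegular Λ g)
    {S₀ : Type} [CommRing S₀] [Algebra S₀ Λ] (D₀ : Derivation S₀ Λ Λ) (hD₀ : IsUnit (Ideal.Quotient.mk (Ideal.span {g}) (D₀ g)))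
    (g₂ : MvPolynomial (Fin 5) k) (hg₂ : g₂ = X 0 * X 1 + X 2 * (1 + X 3 ^ 3 + X 4 ^ 3))
    (c₂ : Fin 4 → MvPolynomial (Fin 5) k) (hc₂ : c₂ = ![X 0, X 1, X 2, 1 + X 3 ^ 3 + X 4 ^ 3])
    (J₂ : Ideal (MvPolynomial (Fin 5) k ⧸ Ideal.span {g₂})) (hJ₂ : J₂ = (Ideal.span (Set.range c₂)).map (Ideal.Quotient.mk (Ideal.span {g₂}))) :
    ∀ p : Fin 4, IsRegularRing (blowupAlgebra J₂ (Ideal.Quotient.mk (Ideal.span {g₂}) (c₂ p))) := by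
  obtain ⟨εq, hεq, hJ'⟩ := exists_quotientEquiv_chartTwo k ι g₂ hg₂ c₂ hc₂ J₂ hJ₂ g hg _ rfl _ rfl
  have hreg := ODPCurveBlowupRegular.isRegularRing_blowupAlgebra_strictTransform g _ _ hg0 D₀ hD₀ rfl rfl _ rfl
  intro p
  exact isRegularRing_blowupAlgebra_of_ringEquiv εq J₂ _ _ _ hJ'.symm (hεq p).symm (hreg p)

/-- `Sing = V(J₂)` over an ABSTRACT copy `Λ` of `k[U,V]` (instantiate with `ι = RingEquiv.refl`). [plumbing] -/
theorem not_isRegularLocalRing_iff_chartTwo_aux (k : Type) [Field k] {Λ : Type} [CommRing Λ] [IsRegularRing Λ] [IsDomain Λ]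
    (ι : MvPolynomial (Fin 2) k ≃+* Λ) (g : Λ) (hg : g = ι (1 + X 0 ^ 3 + X 1 ^ 3)) (hg0 : g ≠ 0)
    {S₀ : Type} [CommRing S₀] [Algebra S₀ Λ] (D₀ : Derivation S₀ Λ Λ) (hD₀ : IsUnit (Ideal.Quotient.mk (Ideal.span {g}) (D₀ g)))
    (g₂ : MvPolynomial (Fin 5) k) (hg₂ : g₂ = X 0 * X 1 + X 2 * (1 + X 3 ^ 3 + X 4 ^ 3))
    (c₂ : Fin 4 → MvPolynomial (Fin 5) k) (hc₂ : c₂ = ![X 0, X 1, X 2, 1 + X 3 ^ 3 + X 4 ^ 3])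
    (J₂ : Ideal (MvPolynomial (Fin 5) k ⧸ Ideal.span {g₂})) (hJ₂ : J₂ = (Ideal.span (Set.range c₂)).map (Ideal.Quotient.mk (Ideal.span {g₂})))
    (P : Ideal (MvPolynomial (Fin 5) k ⧸ Ideal.span {g₂})) [P.IsPrime] :
    ¬ IsRegularLocalRing (Localization.AtPrime P) ↔ J₂ ≤ P := by
  obtain ⟨εq, -, hJ⟩ := exists_quotientEquiv_chartTwo k ι g₂ hg₂ c₂ hc₂ J₂ hJ₂ g hg _ rfl _ rfl
  haveI hQ : (P.map εq).IsPrime := Ideal.map_isPrime_of_equiv εq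
  have hPc : P = (P.map εq).comap εq := (Ideal.comap_map_of_bijective εq εq.bijective).symm
  have key := ODPCurveBlowupRegular.not_isRegularLocalRing_iff_map_le g _ _ hg0 D₀ hD₀ rfl rfl (P.map εq)
  rw [isRegularLocalRing_localization_iff_of_ringEquiv εq P (P.map εq) hPc, key, ← hJ, Ideal.map_le_iff_le_comap, ← hPc]

/-- ★★ **THE FOUR CHART RINGS OF THE BLOWING UP OF `C₂ = k[X₀..X₄]/(X₀X₁ + X₂(1 + X₃³ + X₄³))` ALONG `J₂ = (X₀, X₁, X₂, 1 + X₃³ + X₄³)·C₂` ARE REGULAR**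
(`3 ≠ 0` in `k`, e.g. characteristic 2; chart `D₊(w₁)` of `Bl_𝔪 G`, `G = {ab + w₁³ + w₂³ + w₃³}`, in the coordinates of `E4GermPointBlowupFull.theta`).
[folklore; cite: Liu2002, Thm. 8.1.19 (a); GortzWedhorn2020, Prop. 13.96 (2)] -/
theorem isRegularRing_blowupAlgebra_chartTwo (k : Type) [Field k] (h3 : (3 : k) ≠ 0)
    (g₂ : MvPolynomial (Fin 5) k) (hg₂ : g₂ = X 0 * X 1 + X 2 * (1 + X 3 ^ 3 + X 4 ^ 3))
    (c₂ : Fin 4 → MvPolynomial (Fin 5) k) (hc₂ : c₂ = ![X 0, X 1, X 2, 1 + X 3 ^ 3 + X 4 ^ 3])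
    (J₂ : Ideal (MvPolynomial (Fin 5) k ⧸ Ideal.span {g₂})) (hJ₂ : J₂ = (Ideal.span (Set.range c₂)).map (Ideal.Quotient.mk (Ideal.span {g₂}))) :
    ∀ p : Fin 4, IsRegularRing (blowupAlgebra J₂ (Ideal.Quotient.mk (Ideal.span {g₂}) (c₂ p))) :=
  haveI := isDomain_quotient_g k h3 (1 + X 0 ^ 3 + X 1 ^ 3) rfl
  isRegularRing_blowupAlgebra_chartTwo_aux k (RingEquiv.refl _) (1 + X 0 ^ 3 + X 1 ^ 3) rfl
    (ODPCurveCentre.isSMulRegular_of_ne_zero _ (g_ne_zero k h3 _ rfl)) _ (isUnit_mk_euler_g k h3 _ rfl) g₂ hg₂ c₂ hc₂ J₂ hJ₂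

/-- ★★ **`Bl_{J₂} Spec C₂` IS A REGULAR SCHEME** (`3 ≠ 0` in `k`). [folklore; cite: Liu2002, Thm. 8.1.19 (a); GortzWedhorn2020, (13.19)] -/
theorem isRegular_affineBlowup_chartTwo (k : Type) [Field k] (h3 : (3 : k) ≠ 0)
    (g₂ : MvPolynomial (Fin 5) k) (hg₂ : g₂ = X 0 * X 1 + X 2 * (1 + X 3 ^ 3 + X 4 ^ 3))
    (c₂ : Fin 4 → MvPolynomial (Fin 5) k) (hc₂ : c₂ = ![X 0, X 1, X 2, 1 + X 3 ^ 3 + X 4 ^ 3])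
    (J₂ : Ideal (MvPolynomial (Fin 5) k ⧸ Ideal.span {g₂})) (hJ₂ : J₂ = (Ideal.span (Set.range c₂)).map (Ideal.Quotient.mk (Ideal.span {g₂}))) :
    Scheme.IsRegular (affineBlowup J₂) := by
  refine affineBlowup.isRegular_of_isRegularRing_blowupAlgebra (fun p : Fin 4 => Ideal.Quotient.mk (Ideal.span {g₂}) (c₂ p))
    (fun p => ?_) ?_ (isRegularRing_blowupAlgebra_chartTwo k h3 g₂ hg₂ c₂ hc₂ J₂ hJ₂)
  · rw [hJ₂]; exact Ideal.mem_map_of_mem _ (Ideal.subset_span ⟨p, rfl⟩)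
  · rw [hJ₂, Ideal.map_span, ← Set.range_comp]
    exact le_rfl

/-- ★ **`Sing(Spec C₂) = V(J₂)`**: a prime `P` of `C₂` is a singular point (`(C₂)_P` not regular) iff `P ⊇ J₂` (`3 ≠ 0` in `k`) — the ring side of the E4″ (F2) chart
identification «𝓚_E|_{D₊(w₁)} = J̃₂». [cite: StacksProject, Tag 07PF] [cite: Matsumura1987, Thm. 14.2] -/
theorem not_isRegularLocalRing_iff_chartTwo (k : Type) [Field k] (h3 : (3 : k) ≠ 0)
    (g₂ : MvPolynomial (Fin 5) k) (hg₂ : g₂ = X 0 * X 1 + X 2 * (1 + X 3 ^ 3 + X 4 ^ 3))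
    (c₂ : Fin 4 → MvPolynomial (Fin 5) k) (hc₂ : c₂ = ![X 0, X 1, X 2, 1 + X 3 ^ 3 + X 4 ^ 3])
    (J₂ : Ideal (MvPolynomial (Fin 5) k ⧸ Ideal.span {g₂})) (hJ₂ : J₂ = (Ideal.span (Set.range c₂)).map (Ideal.Quotient.mk (Ideal.span {g₂})))
    (P : Ideal (MvPolynomial (Fin 5) k ⧸ Ideal.span {g₂})) [P.IsPrime] :
    ¬ IsRegularLocalRing (Localization.AtPrime P) ↔ J₂ ≤ P :=
  not_isRegularLocalRing_iff_chartTwo_aux k (RingEquiv.refl _) (1 + X 0 ^ 3 + X 1 ^ 3) rfl (g_ne_zero k h3 _ rfl) _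
    (isUnit_mk_euler_g k h3 _ rfl) g₂ hg₂ c₂ hc₂ J₂ hJ₂ P

end Summit.ResolutionOfSingularities.ResolutionOfSingularities.Theorems.FInjectiveMacaulayfication.E4FloorTwoWChart

end
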